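import Literature.AlgebraicGeometry.Resolution.NewtonNondegenerate
import HarnessLib

/-!
# CI NEWTON NON-DEGENERACY (Khovanskii 1977 / Cueto–Popescu-Pampu–Stepanov 2023 Def. 4.2): the DEFINITIONS
# (crux `FInjectiveMacaulayfication` stmt-ResolutionOfSingularities-15315, chain w45a; res-L1-w45a-plan-1 RULING R23.3 (A1) «GO as an OURS Defs file summit-side»; seat
# res-L1-w45a-stub-2 g12; checkpoint signature `L/res-L1-w45a-stub-2/g12/CINondegenerateSig.lean`)

[OURS · L1 W4.5a] Definition file (review lane). Two `Prop`-valued PREDICATES with parameters (a weight / a tuple of power series) — a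
published NOTION, typed in the vocabulary of ✓ `Literature/AlgebraicGeometry/Resolution/NewtonNondegenerate.lean` (`BoubakriGreuelMarkwig.initialForm`,
`evalAt`, `InTorus`); no instance, no notation, no named fact, no axiom; NOT a statement of any manuscript; AI-written (AI review is weaker than
expert review). Consumers: the CI-Ishii chart lemma / CI `hon'` clause / CI class row of this seat's programme (A) «GAP-2 member NON-HYPERSURFACE at
class level» (R23.2 (4)(ii), R23.3).

THE PRINT. [CuetoPopescupampuStepanov2023, Def. 4.2 (p. 12)]: «Fix a positive integer `s` and a regular sequence `(f₁, …, f_s)` in `𝒪̂`. The sequence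
defines a Newton non-degenerate complete intersection if for any positive weight vector `w ∈ (ℝ_{>0})ⁿ`, the hypersurfaces defined by each `in_w f_i` form a
normal crossings divisor in a neighborhood of their intersection with the dense torus. Equivalently, the differentials of the initial forms
`in_w f₁, …, in_w f_s` must be linearly independent at each point of the intersection.» (their Remark 4.4: this «modifies slightly Khovanskii's original
definition [K 77] by imposing the regularity of the sequence»). WE TYPE THE «EQUIVALENTLY» CLAUSE, for an arbitrary field `K` (the print: `ℂ`), and
WITHOUT the standing hypothesis «regular sequence» (consumers carry primality / dimension separately, as the hypersurface class theorems do):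
* `IsCINondegenerateAlong w F` — at every point `q` of the torus `(K*)ⁿ` where ALL `in_w(F_l)` vanish, the gradient rows
  `(∂ in_w(F_l)/∂x_i (q))_i`, `l < r`, are linearly independent over `K` (the Jacobian has rank `r`);
* `IsCINewtonNondegenerate F` — the same along every positive weight;
* sanity `isCINondegenerateAlong_one_iff` — for `r = 1` this is EXACTLY ✓ `BoubakriGreuelMarkwig.IsWeaklyNondegenerateAlong` (the Tjurina form: no torus
  point is a common zero of `in_w f` and its gradient), so no second notion is introduced for hypersurfaces.
As with `IsWeaklyNondegenerateAlong`, the quantifier runs over `K`-RATIONAL torus points; over a non-closed field the honest hypothesis is the predicate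
for `map (algebraMap k K) ∘ F` with `K ⊇ k` algebraically closed (GEOMETRIC non-degeneracy), exactly as in ✓ `…F108ClassRowAnyField`.
[cite: CuetoPopescupampuStepanov2023, Def. 4.2 (p. 12) and Rem. 4.4] [cite: BoubakriGreuelMarkwig2010, §3 (p. 10)]
-/

-- single-problem summit: the doubled namespace component is forced
set_option linter.dupNamespace false
set_option autoImplicit false

noncomputable section

namespace Summit.ResolutionOfSingularities.ResolutionOfSingularities.Theorems.FInjectiveMacaulayfication.CINondegenerate

open Literature.AlgebraicGeometry.Resolution Literature.AlgebraicGeometry.Resolution.BoubakriGreuelMarkwig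

variable {K : Type} [Field K] {n r : ℕ}

/-- **Newton non-degenerate complete intersection ALONG a weight** (Khovanskii; [CuetoPopescupampuStepanov2023, Def. 4.2], the «equivalently»
clause): at every point `q` of the torus `(K*)ⁿ` at which all the initial forms `in_w(F₀), …, in_w(F_{r−1})` vanish, the family of gradient rows
`l ↦ (i ↦ ∂ in_w(F_l)/∂x_i (q))` is linearly independent over `K`. Vacuous when the initial forms have no common torus zero (their Remark 4.3).
[OURS · predicate typing a published notion; cite: CuetoPopescupampuStepanov2023, Def. 4.2 (p. 12)] -/
def IsCINondegenerateAlong (w : Fin n → ℝ) (F : Fin r → MvPowerSeries (Fin n) K) : Prop :=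
  ∀ q : Fin n → K, InTorus q → (∀ l : Fin r, BoubakriGreuelMarkwig.evalAt (initialForm w (F l)) q = 0) →
    LinearIndependent K (fun l : Fin r => fun i : Fin n => BoubakriGreuelMarkwig.evalAt (MvPowerSeries.pderiv i (initialForm w (F l))) q)

/-- **Newton non-degenerate complete intersection**: non-degenerate along EVERY positive weight vector. [OURS · predicate typing a published notion;
cite: CuetoPopescupampuStepanov2023, Def. 4.2 (p. 12)] -/
def IsCINewtonNondegenerate (F : Fin r → MvPowerSeries (Fin n) K) : Prop :=
  ∀ w : Fin n → ℝ, (∀ i, 0 < w i) → IsCINondegenerateAlong w F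

/-- SANITY (`r = 1`): CI non-degeneracy of the one-term tuple `![f]` along `w` is BGM's WEAK (Tjurina) non-degeneracy of `f` along `w` — a single
gradient row is linearly independent iff it is non-zero, i.e. iff `q` is not a Jacobian zero. [folklore] -/
theorem isCINondegenerateAlong_one_iff (w : Fin n → ℝ) (f : MvPowerSeries (Fin n) K) :
    IsCINondegenerateAlong w ![f] ↔ IsWeaklyNondegenerateAlong w f := by
  unfold IsCINondegenerateAlong IsWeaklyNondegenerateAlong IsTjurinaZero IsJacobianZero
  refine forall_congr' fun q => forall_congr' fun _ => ?_
  simp only [Fin.forall_fin_one, Matrix.cons_val_fin_one, linearIndependent_unique_iff, ne_eq, funext_iff, Pi.zero_apply, not_forall,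
    not_and]

/-- The «along every weight» forms agree likewise for `r = 1`. [folklore] -/
theorem isCINewtonNondegenerate_one_iff (f : MvPowerSeries (Fin n) K) :
    IsCINewtonNondegenerate ![f] ↔ ∀ w : Fin n → ℝ, (∀ i, 0 < w i) → IsWeaklyNondegenerateAlong w f :=
  forall_congr' fun w => forall_congr' fun _ => isCINondegenerateAlong_one_iff w f

end Summit.ResolutionOfSingularities.ResolutionOfSingularities.Theorems.FInjectiveMacaulayfication.CINondegenerate

end
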